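import Literature.Geometry.Lorentzian.CoordChristoffelDerivative

/-!
# Route EIHFluxBalance — `InertialRecession` (E′), stub `stub_slaving`:
# the second-time-derivative slot of the coordinate Ricci form is the principal symbol, and the
# principal symbol has no kernel on Kerr–Schild parameter derivatives ("pointwise Killing lemma")

Helper file for the crux `stmt-FinalStateConjecture-17403`
(`Summit.FinalStateConjecture.FinalStateConjecture.Theses.EIHFluxBalance.InertialRecession`, E′),
stub `stub_slaving` (frozen-vacuum slaving, `…StubSlaving12Reduction`), part (B1) of the all-boost
coercivity programme (memo `COER_allboosts_routes.md`, item evidence): the `J²`-block of the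
jet ↦ Ricci map of one painted summand.

* `ricAt_apply_eq_add_symbol_of_jets` — **the `∂₀∂₀`-slot of `Ric` is the principal symbol.**
  If two fields of metric components `G, G'` on an open `V ∋ x` have the same `1`-jet at `x` and
  second derivatives differing by `D²G'(x)(v)(w) = D²G(x)(v)(w) + ζ(v) ζ(w) B` (`ζ` a covector,
  `B` a bilinear form — two painted metrics with different second jets `J²`, `ζ = dx⁰`), then
  `Ric'(Y,Z) = Ric(Y,Z) + ½[ζ(Z) ζ(♯B(·,Y)) + ζ(Y) B(♯ζ, Z) − ζ(♯ζ) B(Y,Z) − ζ(Y) ζ(Z) tr_G Bᵗ]`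
  (`= σ_G(ζ)B`, the principal symbol of the linearised Ricci operator; O'Neill 1983, Lemma 3.52:
  only `∂Γ` sees `D²G`, through `koszulOp` — `IsMetricOn.fderiv_chrAt_apply_eq`; the steps are
  `fderiv_chrAt_apply_eq_add_of_jets`, `riemAt_apply_eq_add_of_jets`).
* `eq_zero_of_symbol_nullPair_row_eq_zero` (and the full-symbol form
  `eq_zero_of_symbol_nullPair_eq_zero`) — **kernel lemma.** For covectors `ζ, ℓ, m` and an index
  raising `S` with `ℓ(Sℓ) = 0`, `m(Sℓ) = 0` (every first derivative `ℓ ⊗ m + m ⊗ ℓ` of a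
  Kerr–Schild metric `η + 2H ℓ ⊗ ℓ`, `m = 2(∂H)ℓ + 4H ∂ℓ`) and `ζ(Sℓ) ≠ 0`, `ℓ(Sζ) ≠ 0` (a slicing
  covector against a null `ℓ`): the `Y = Sℓ` row of `σ(ζ)(ℓ ⊗ m + m ⊗ ℓ) = 0` already forces
  `m = 0` (at `Z = Sℓ` it gives `τ = 0`, at `Z = Sζ` then `m(Sζ) = 0`, and then `ℓ(Sζ) m = 0`).
* `eq_zero_of_ricAt_row_eq_of_jets` — **(B1) assembled**: a `ζ ⊗ ζ ⊗ (ℓ ⊗ m + m ⊗ ℓ)` change of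
  the second jet with `m ≠ 0` changes the Ricci row `Ric(♯ℓ, ·)`. Pointwise statement behind the
  injectivity of the `J²`-block of the jet ↦ Ricci map of a painted Kerr–Schild summand, for every
  boost (the slicing covector only needs `g♯(ζ,ℓ) ≠ 0`).

Pure coordinate tensor algebra (`Literature.Geometry.Lorentzian.MetricCoord`); no definitions, no
named facts, no `sorry`.
-/

set_option linter.dupNamespace false
set_option maxSynthPendingDepth 3

noncomputable section

open Set Function ContinuousLinearMap Literature.Geometry.Lorentzian
  Literature.Geometry.Lorentzian.MetricCoord

namespace Summit.FinalStateConjecture.FinalStateConjecture.Theorems.SublinearIsFree.Slaving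

/-! ### The kernel lemma (pure algebra) -/

section Kernel

variable {E : Type*} [NormedAddCommGroup E] [NormedSpace ℝ E]

/-- **Kernel lemma ("pointwise Killing lemma") for the principal symbol on Kerr–Schild parameter
derivatives.** Let `S : E* → E` be any linear index raising and `ζ, ℓ, m ∈ E*` with `ℓ(Sℓ) = 0`,
`m(Sℓ) = 0` (as for every first derivative `B = ℓ ⊗ m + m ⊗ ℓ` of a Kerr–Schild metric
`η + 2H ℓ ⊗ ℓ`: `m = 2(∂H)ℓ + 4H ∂ℓ`, `ℓ` null), `ζ(Sℓ) ≠ 0` and `ℓ(Sζ) ≠ 0` (a slicing covector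
transverse to the null direction). If for some real `τ` the row `Y = Sℓ` of the principal-symbol
identity holds, `ζ(Sℓ) (ℓ(Sζ) m(Z) + m(Sζ) ℓ(Z)) − τ ζ(Sℓ) ζ(Z) = 0` for all `Z` (this is
`2σ(ζ)B(Sℓ, Z) = 0`, because `B(Sℓ, ·) = 0`), then `m = 0`: at `Z = Sℓ` one reads `τ = 0`, at
`Z = Sζ` then `m(Sζ) = 0`, and the row itself gives `ℓ(Sζ) m = 0`. [folklore] -/
theorem eq_zero_of_symbol_nullPair_row_eq_zero (S : (E →L[ℝ] ℝ) →L[ℝ] E) (ζ ℓ m : E →L[ℝ] ℝ)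
    (τ : ℝ) (hℓℓ : ℓ (S ℓ) = 0) (hmℓ : m (S ℓ) = 0) (hζℓ : ζ (S ℓ) ≠ 0) (hℓζ : ℓ (S ζ) ≠ 0)
    (hrow : ∀ Z : E, ζ (S ℓ) * (ℓ (S ζ) * m Z + m (S ζ) * ℓ Z) - τ * (ζ (S ℓ) * ζ Z) = 0) :
    m = 0 := by
  have h1 : ∀ Z : E, ℓ (S ζ) * m Z + m (S ζ) * ℓ Z = τ * ζ Z := by
    intro Z
    have h' : ζ (S ℓ) * (ℓ (S ζ) * m Z + m (S ζ) * ℓ Z - τ * ζ Z) = 0 := by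
      linear_combination hrow Z
    linarith [(mul_eq_zero.1 h').resolve_left hζℓ]
  have hτ : τ = 0 := by
    have h := h1 (S ℓ)
    rw [hℓℓ, hmℓ, mul_zero, mul_zero, add_zero] at h
    exact (mul_eq_zero.1 h.symm).resolve_right hζℓ
  have hmζ : m (S ζ) = 0 := by
    have h := h1 (S ζ)
    rw [hτ, zero_mul] at h
    have h' : (2 * ℓ (S ζ)) * m (S ζ) = 0 := by linear_combination h
    exact (mul_eq_zero.1 h').resolve_left (mul_ne_zero two_ne_zero hℓζ)
  ext Z
  have h := h1 Z
  rw [hτ, zero_mul, hmζ, zero_mul, add_zero] at h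
  exact (mul_eq_zero.1 h).resolve_left hℓζ

/-- **Kernel lemma, full-symbol form**: the same conclusion from the vanishing of the whole
principal-symbol expression `ζ(Z) ζ(S B(Y,·)) + ζ(Y) B(Sζ, Z) − c B(Y,Z) − τ ζ(Y) ζ(Z)`
(`B = ℓ ⊗ m + m ⊗ ℓ`, any reals `c, τ`), of which only the row `Y = Sℓ` is used. [folklore] -/
theorem eq_zero_of_symbol_nullPair_eq_zero (S : (E →L[ℝ] ℝ) →L[ℝ] E) (ζ ℓ m : E →L[ℝ] ℝ)
    (c τ : ℝ) (hℓℓ : ℓ (S ℓ) = 0) (hmℓ : m (S ℓ) = 0) (hζℓ : ζ (S ℓ) ≠ 0) (hℓζ : ℓ (S ζ) ≠ 0)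
    (hσ : ∀ Y Z : E, ζ Z * ζ (S (ℓ Y • m + m Y • ℓ)) + ζ Y * (ℓ (S ζ) * m Z + m (S ζ) * ℓ Z)
      - c * (ℓ Y * m Z + m Y * ℓ Z) - τ * (ζ Y * ζ Z) = 0) :
    m = 0 := by
  refine eq_zero_of_symbol_nullPair_row_eq_zero S ζ ℓ m τ hℓℓ hmℓ hζℓ hℓζ fun Z ↦ ?_
  have h := hσ (S ℓ) Z
  simp only [hℓℓ, hmℓ, zero_smul, add_zero, map_zero, mul_zero, zero_mul, zero_add] at h
  linear_combination h

end Kernel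

/-! ### The `∂₀∂₀`-slot of the Ricci form is the principal symbol -/

section Slot

variable {E : Type*} [NormedAddCommGroup E] [NormedSpace ℝ E] [CompleteSpace E]
  {G G' : E → E →L[ℝ] E →L[ℝ] ℝ} {V : Set E} {x : E}

omit [CompleteSpace E] in
/-- Same `0`-jet ⇒ same index raising. [folklore] -/
theorem sharpAt_eq_of_apply_eq (h0 : G' x = G x) : sharpAt G' x = sharpAt G x := by
  simp only [sharpAt, h0]

omit [CompleteSpace E] in
/-- Same `1`-jet ⇒ same Koszul form. [folklore] -/
theorem koszulCLM_eq_of_fderiv_eq (h1 : fderiv ℝ G' x = fderiv ℝ G x) :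
    koszulCLM G' x = koszulCLM G x := by
  simp only [koszulCLM, h1]

omit [CompleteSpace E] in
/-- Same `1`-jet ⇒ same Christoffel map. [folklore] -/
theorem chrAt_eq_of_jet₁_eq (h0 : G' x = G x) (h1 : fderiv ℝ G' x = fderiv ℝ G x) :
    chrAt G' x = chrAt G x := by
  ext X Y
  rw [chrAt_apply, chrAt_apply, sharpAt_eq_of_apply_eq h0, koszulCLM_eq_of_fderiv_eq h1]

/-- **The derivative of the Christoffel map under a change of the second jet along `ζ ⊗ ζ`.**
If `G, G'` are metric components on `V ∋ x` with the same `1`-jet at `x` and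
`D²G'(x)(v) = D²G(x)(v) + ζ(v) • (w ↦ ζ(w) B)`, then
`DΓ'(v)(X) = DΓ(v)(X) + ½ ζ(v) • ♯ ∘ (ζ(X) B(·,·)-Koszul)`, precisely
`DΓ'(v)(X)(Y) = DΓ(v)(X)(Y) + ½ ζ(v) ♯(ζ(X) B(Y,·) + ζ(Y) B(·,X) − B(X,Y) ζ)`. [cite: ONeill1983, Ch. 3, Prop. 3.13] -/
theorem fderiv_chrAt_apply_eq_add_of_jets (hG : IsMetricOn G V) (hG' : IsMetricOn G' V)
    (hx : x ∈ V) (h0 : G' x = G x) (h1 : fderiv ℝ G' x = fderiv ℝ G x)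
    {ζ : E →L[ℝ] ℝ} {B : E →L[ℝ] E →L[ℝ] ℝ}
    (h2 : ∀ v, fderiv ℝ (fderiv ℝ G') x v = fderiv ℝ (fderiv ℝ G) x v + ζ v • ζ.smulRight B)
    (v X Y : E) :
    fderiv ℝ (chrAt G') x v X Y = fderiv ℝ (chrAt G) x v X Y +
      (2⁻¹ * ζ v) • sharpAt G x (ζ X • B Y + ζ Y • B.flip X - B X Y • ζ) := by
  have hS : sharpAt G' x = sharpAt G x := sharpAt_eq_of_apply_eq h0
  have hK : koszulCLM G' x = koszulCLM G x := koszulCLM_eq_of_fderiv_eq h1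
  have hDS : fderiv ℝ (sharpAt G') x v = fderiv ℝ (sharpAt G) x v := by
    rw [hG.fderiv_sharpAt hx v, hG'.fderiv_sharpAt hx v, hS, h1]
  have hkos : koszulOp (ζ.smulRight B) X Y = ζ X • B Y + ζ Y • B.flip X - B X Y • ζ := by
    ext W
    simp only [koszulOp_apply, ContinuousLinearMap.smulRight_apply, sub_apply, add_apply,
      FunLike.coe_smul, Pi.smul_apply, ContinuousLinearMap.flip_apply, smul_eq_mul]
    ring
  rw [hG'.fderiv_chrAt_apply_eq hx v X, hG.fderiv_chrAt_apply_eq hx v X, hDS, hK, hS, h2 v,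
    map_add, map_smul]
  simp only [FunLike.coe_smul, Pi.smul_apply, add_apply, ContinuousLinearMap.comp_apply, hkos,
    map_smul, smul_add, map_add, mul_smul]
  abel

/-- **The curvature endomorphism under a change of the second jet along `ζ ⊗ ζ`**:
`R'(X,Y)Z = R(X,Y)Z + ½ ζ(X) ♯(ζ(Y) B(Z,·) + ζ(Z) B(·,Y) − B(Y,Z) ζ) − ½ ζ(Y) ♯(ζ(X) B(Z,·) + ζ(Z) B(·,X) − B(X,Z) ζ)`
(the `ΓΓ` terms see only the `1`-jet). [cite: ONeill1983, Ch. 3, Lemma 3.38] -/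
theorem riemAt_apply_eq_add_of_jets (hG : IsMetricOn G V) (hG' : IsMetricOn G' V)
    (hx : x ∈ V) (h0 : G' x = G x) (h1 : fderiv ℝ G' x = fderiv ℝ G x)
    {ζ : E →L[ℝ] ℝ} {B : E →L[ℝ] E →L[ℝ] ℝ}
    (h2 : ∀ v, fderiv ℝ (fderiv ℝ G') x v = fderiv ℝ (fderiv ℝ G) x v + ζ v • ζ.smulRight B)
    (X Y Z : E) :
    riemAt G' x X Y Z = riemAt G x X Y Z
      + (2⁻¹ * ζ X) • sharpAt G x (ζ Y • B Z + ζ Z • B.flip Y - B Y Z • ζ)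
      - (2⁻¹ * ζ Y) • sharpAt G x (ζ X • B Z + ζ Z • B.flip X - B X Z • ζ) := by
  rw [riemAt_apply, riemAt_apply, chrAt_eq_of_jet₁_eq h0 h1,
    fderiv_chrAt_apply_eq_add_of_jets hG hG' hx h0 h1 h2 X Y Z,
    fderiv_chrAt_apply_eq_add_of_jets hG hG' hx h0 h1 h2 Y X Z]
  abel

/-- **The `∂₀∂₀`-slot of the Ricci form is the principal symbol.** If two fields of metric
components on an open `V ∋ x` have the same `1`-jet at `x` and
`D²G'(x)(v)(w) = D²G(x)(v)(w) + ζ(v) ζ(w) B`, then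
`Ric'(Y,Z) = Ric(Y,Z) + ½ [ζ(Z) ζ(♯B(·,Y)) + ζ(Y) B(♯ζ, Z) − ζ(♯ζ) B(Y,Z) − ζ(Y) ζ(Z) tr_G B(·,·)ᵗ]`,
the value on `B` of the principal symbol `σ_G(ζ)` of the linearised Ricci operator (O'Neill 1983,
Lemma 3.52: the trace of `riemAt_apply_eq_add_of_jets`; traces of rank-one maps and
`tr(♯ ∘ Bᵗ) = mtrAt G x B.flip`). [cite: ONeill1983, Ch. 3, Lemma 3.52] -/
theorem ricAt_apply_eq_add_symbol_of_jets [FiniteDimensional ℝ E] (hG : IsMetricOn G V) (hG' : IsMetricOn G' V)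
    (hx : x ∈ V) (h0 : G' x = G x) (h1 : fderiv ℝ G' x = fderiv ℝ G x)
    {ζ : E →L[ℝ] ℝ} {B : E →L[ℝ] E →L[ℝ] ℝ}
    (h2 : ∀ v, fderiv ℝ (fderiv ℝ G') x v = fderiv ℝ (fderiv ℝ G) x v + ζ v • ζ.smulRight B)
    (Y Z : E) :
    ricAt G' x Y Z = ricAt G x Y Z + 2⁻¹ * (ζ Z * ζ (sharpAt G x (B.flip Y))
      + ζ Y * B (sharpAt G x ζ) Z - ζ (sharpAt G x ζ) * B Y Z
      - ζ Y * ζ Z * mtrAt G x B.flip) := by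
  -- the perturbation of the endomorphism `X ↦ R(X,Y)Z`, as a linear map
  set S := sharpAt G x with hSdef
  set M : E →ₗ[ℝ] E :=
    (2⁻¹ : ℝ) • ((ζ : E →ₗ[ℝ] ℝ).smulRight (S (ζ Y • B Z + ζ Z • B.flip Y - B Y Z • ζ))
      - ζ Y • (ζ : E →ₗ[ℝ] ℝ).smulRight (S (B Z))
      - (ζ Y * ζ Z) • ((S.comp B.flip : E →L[ℝ] E) : E →ₗ[ℝ] E)
      + ζ Y • ((B.flip Z : E →L[ℝ] ℝ) : E →ₗ[ℝ] ℝ).smulRight (S ζ)) with hM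
  have hendo : ricciEndo G' x Y Z = ricciEndo G x Y Z + M := by
    apply LinearMap.ext
    intro X
    rw [LinearMap.add_apply, ricciEndo_apply, ricciEndo_apply,
      riemAt_apply_eq_add_of_jets hG hG' hx h0 h1 h2 X Y Z, hM]
    simp only [LinearMap.add_apply, LinearMap.sub_apply, LinearMap.smul_apply,
      LinearMap.smulRight_apply, ContinuousLinearMap.coe_coe, ContinuousLinearMap.coe_comp,
      Function.comp_apply, ContinuousLinearMap.flip_apply, map_add, map_sub, map_smul, smul_sub,
      smul_add, smul_smul, hSdef]
    module
  rw [ricAt_apply, ricAt_apply, hendo, map_add, hM]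
  have htr : LinearMap.trace ℝ E ((S.comp B.flip : E →L[ℝ] E) : E →ₗ[ℝ] E) = mtrAt G x B.flip := rfl
  simp only [map_add, map_sub, map_smul, LinearMap.trace_smulRight, smul_eq_mul,
    ContinuousLinearMap.coe_coe, htr, ContinuousLinearMap.flip_apply]
  ring

/-- **(B1) for metric components: a `ζ ⊗ ζ ⊗ (ℓ ⊗ m + m ⊗ ℓ)` change of the second jet is seen by
the Ricci row at `♯ℓ`.** If `G, G'` are metric components on an open `V ∋ x` with the same `1`-jet
at `x` and `D²G'(x)(v)(w) = D²G(x)(v)(w) + ζ(v) ζ(w) (ℓ ⊗ m + m ⊗ ℓ)`, where `ℓ(♯ℓ) = 0`,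
`m(♯ℓ) = 0` (e.g. `G` Kerr–Schild, `ℓ` its null covector, `ℓ ⊗ m + m ⊗ ℓ` any first parameter
derivative), `ζ(♯ℓ) ≠ 0` and `ℓ(♯ζ) ≠ 0` (e.g. `ζ = dx⁰`), and the Ricci rows at `♯ℓ` agree,
`Ric'(♯ℓ, ·) = Ric(♯ℓ, ·)`, then `m = 0` (`ricAt_apply_eq_add_symbol_of_jets` and the kernel lemma
`eq_zero_of_symbol_nullPair_row_eq_zero`). This is the pointwise statement behind the injectivity
of the `J²`-block of the jet ↦ Ricci map of a painted Kerr–Schild summand. [folklore] -/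
theorem eq_zero_of_ricAt_row_eq_of_jets [FiniteDimensional ℝ E] (hG : IsMetricOn G V)
    (hG' : IsMetricOn G' V) (hx : x ∈ V) (h0 : G' x = G x) (h1 : fderiv ℝ G' x = fderiv ℝ G x)
    {ζ ℓ m : E →L[ℝ] ℝ}
    (h2 : ∀ v, fderiv ℝ (fderiv ℝ G') x v =
      fderiv ℝ (fderiv ℝ G) x v + ζ v • ζ.smulRight (ℓ.smulRight m + m.smulRight ℓ))
    (hℓℓ : ℓ (sharpAt G x ℓ) = 0) (hmℓ : m (sharpAt G x ℓ) = 0) (hζℓ : ζ (sharpAt G x ℓ) ≠ 0)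
    (hℓζ : ℓ (sharpAt G x ζ) ≠ 0)
    (hrow : ∀ Z, ricAt G' x (sharpAt G x ℓ) Z = ricAt G x (sharpAt G x ℓ) Z) : m = 0 := by
  refine eq_zero_of_symbol_nullPair_row_eq_zero (sharpAt G x) ζ ℓ m
    (mtrAt G x (ℓ.smulRight m + m.smulRight ℓ).flip) hℓℓ hmℓ hζℓ hℓζ fun Z ↦ ?_
  have h := ricAt_apply_eq_add_symbol_of_jets hG hG' hx h0 h1 h2 (sharpAt G x ℓ) Z
  rw [hrow] at h
  have hflip : (ℓ.smulRight m + m.smulRight ℓ).flip (sharpAt G x ℓ) = 0 := by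
    ext W
    simp [ContinuousLinearMap.flip_apply, ContinuousLinearMap.smulRight_apply, hℓℓ, hmℓ]
  rw [hflip, map_zero, map_zero, mul_zero] at h
  simp only [add_apply, ContinuousLinearMap.smulRight_apply, FunLike.coe_smul, Pi.smul_apply,
    smul_eq_mul, hℓℓ, hmℓ, zero_mul, mul_zero, add_zero, zero_add] at h
  linear_combination (-2 : ℝ) * h

end Slot

/-- **Registered one-line carrier form** (`coer_ricAt_row_jet_rigidity_s0`) of
`eq_zero_of_ricAt_row_eq_of_jets` on `E4`. [folklore] -/
theorem coer_ricAt_row_jet_rigidity_s0 : open Literature.Geometry.Lorentzian in ∀ {G G' : E4 → E4 →L[ℝ] E4 →L[ℝ] ℝ} {V : Set E4} {x : E4}, MetricCoord.IsMetricOn G V → MetricCoord.IsMetricOn G' V → x ∈ V → G' x = G x → fderiv ℝ G' x = fderiv ℝ G x → ∀ {ζ ℓ m : E4 →L[ℝ] ℝ}, (∀ v, fderiv ℝ (fderiv ℝ G') x v = fderiv ℝ (fderiv ℝ G) x v + ζ v • ζ.smulRight (ℓ.smulRight m + m.smulRight ℓ)) → ℓ (MetricCoord.sharpAt G x ℓ)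 = 0 → m (MetricCoord.sharpAt G x ℓ) = 0 → ζ (MetricCoord.sharpAt G x ℓ) ≠ 0 → ℓ (MetricCoord.sharpAt G x ζ) ≠ 0 → (∀ Z, MetricCoord.ricAt G' x (MetricCoord.sharpAt G x ℓ) Z = MetricCoord.ricAt G x (MetricCoord.sharpAt G x ℓ) Z) → m = 0 :=
  fun hG hG' hx h0 h1 _ _ _ h2 hℓℓ hmℓ hζℓ hℓζ hrow ↦
    eq_zero_of_ricAt_row_eq_of_jets hG hG' hx h0 h1 h2 hℓℓ hmℓ hζℓ hℓζ hrow

end Summit.FinalStateConjecture.FinalStateConjecture.Theorems.SublinearIsFree.Slaving
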